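import Literature.NumberTheory.EllipticCurves.ManinConstantClassCertificateTwist
import Literature.NumberTheory.EllipticCurves.CuspFormLFunctionLevelConductorProofs
import Summits.BirchSwinnertonDyer.BirchSwinnertonDyer.Theses.ManinLocalTwoThree

/-!
# Route `ManinLocalTwoThree` — level-to-local glue: `p² ∣ N` at the level of the newform of `W`
# forces ADDITIVE reduction of `W` at `p` (helper for both cruxes C2 `ManinOddAtFour` and
# C3 `ManinPrimeToThreeAtNine`; line prover p1, cell bsd-f2-manin)

Pure bookkeeping over landed tree theorems (no new definition, no named fact, no `sorry`):

* `not_good_and_not_mult_of_sq_dvd_conductorNorm` — `p² ∣ N(V)` ⟹ `V` is neither good nor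
  multiplicative at `p` (in the `ℚ_[p]` vocabulary `HasGoodReductionAtPrime` /
  `HasMultiplicativeReductionAtPrime` consumed by the twist-transport certificates
  `not_dvd_maninConstant_of_isTwistOfSemistableAt{Two}_gamma0` and by the Kato line). The converse of
  the tree's `sq_dvd_conductorNorm_of_not_good_of_not_mult`: `v_p(N) = f_v ≥ 2 ↔` additive
  (`natGenerator_sq_dvd_conductorNorm_iff`, Silverman ATAEC IV.10.2 (c)) and the local trichotomy
  (AEC VII.5.1) through the `ℚ_v`/`ℚ_[p]` bridges of `RootNumberProofs`.
* `not_good_and_not_mult_of_sq_dvd_level` — for a datum / newform at LEVEL `N` with `p² ∣ N`, granted the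
  Modularity Theorem `exists_isNewformOf` (the cruxes' own fourth fact binder `hnf`; it yields Carayol's
  `N = N(W)` through `IsNewformOf.level_eq_conductorNorm_of_exists_isNewformOf`).
* `additive_at_two_of_four_dvd_level`, `additive_at_three_of_nine_dvd_level` — the instances the two
  birth skeletons need (`hadd` of `ManinOddAtFour_rung` / `ManinPrimeToThreeAtNine_rung`), and
  `stub_additive_of_nine_dvd_level` — VERBATIM the signature of the stub of that name in the C3 line
  `kato-tame-three` (HOME/imc/lines/es_line_kato_tame_three.lean; es g5), proved.

BSD is not proved by this file; nothing here bears on the truth of BSD.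
-/

set_option autoImplicit false
set_option linter.dupNamespace false

noncomputable section

open scoped MatrixGroups ModularForm

open CongruenceSubgroup WeierstrassCurve IsDedekindDomain Rat.HeightOneSpectrum
  Literature.NumberTheory.EllipticCurves Literature.NumberTheory.EllipticCurves.ModularForms

namespace Summit.BirchSwinnertonDyer.BirchSwinnertonDyer.Theorems.ManinLocalTwoThree

/-! ### `p² ∣ N(V)` ⟹ additive at `p` -/

/-- **Additive reduction at the place `v` over `q` excludes good and multiplicative reduction at `q`**
(in the `ℚ_[q]` vocabulary; Silverman AEC VII.5.1 with the tree's bridges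
`hasGoodReductionAtPrime_primesEquiv_iff_hasGoodReductionAt`,
`hasMultiplicativeReductionAtPrime_primesEquiv_iff_hasMultiplicativeReductionAt`).
[cite: SilvermanAEC2009, VII.5 Prop. 5.1] -/
theorem not_good_and_not_mult_of_hasAdditiveReductionAt {V : WeierstrassCurve ℚ} [V.IsElliptic]
    {v : HeightOneSpectrum ℤ} {q : ℕ} [Fact q.Prime] (hpv : (primesEquiv v : ℕ) = q)
    (h : V.HasAdditiveReductionAt v) :
    ¬ V.HasGoodReductionAtPrime q ∧ ¬ V.HasMultiplicativeReductionAtPrime q := by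
  subst hpv
  refine ⟨fun hg ↦ h.not_hasGoodReductionAt ?_, fun hm ↦ h.not_hasMultiplicativeReductionAt ?_⟩
  · exact (hasGoodReductionAtPrime_primesEquiv_iff_hasGoodReductionAt V v).mp hg
  · exact (hasMultiplicativeReductionAtPrime_primesEquiv_iff_hasMultiplicativeReductionAt V v).mp hm

/-- **`q² ∣ N(V)` ⟹ `V` has additive reduction at `q`** (neither good nor multiplicative):
`v_q(N) = f_q ≥ 2 ↔` additive (Silverman ATAEC IV.10.2 (c), tree
`natGenerator_sq_dvd_conductorNorm_iff`). The converse of the tree's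
`sq_dvd_conductorNorm_of_not_good_of_not_mult`. [cite: Silverman1994, IV.10.2(c)] -/
theorem not_good_and_not_mult_of_sq_dvd_conductorNorm {V : WeierstrassCurve ℚ} [V.IsElliptic]
    {q : ℕ} [Fact q.Prime] (hq : q ^ 2 ∣ V.conductorNorm ℤ) :
    ¬ V.HasGoodReductionAtPrime q ∧ ¬ V.HasMultiplicativeReductionAtPrime q := by
  have hqp : q.Prime := Fact.out
  set v : HeightOneSpectrum ℤ := (primesEquiv (R := ℤ)).symm ⟨q, hqp⟩ with hv
  have hpv : (primesEquiv v : ℕ) = q :=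
    congrArg Subtype.val ((primesEquiv (R := ℤ)).apply_symm_apply ⟨q, hqp⟩)
  have hgen : natGenerator v = q := natGenerator_primesEquiv_symm hqp
  have hadd : V.HasAdditiveReductionAt v := by
    rw [← natGenerator_sq_dvd_conductorNorm_iff v V, hgen]
    exact hq
  exact not_good_and_not_mult_of_hasAdditiveReductionAt hpv hadd

/-- The two directions together: **`q² ∣ N(V)` iff `V` is additive at `q`** (neither good nor
multiplicative in the `ℚ_[q]` vocabulary). [cite: Silverman1994, IV.10.2(c)] -/
theorem sq_dvd_conductorNorm_iff_not_good_and_not_mult {V : WeierstrassCurve ℚ} [V.IsElliptic]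
    {q : ℕ} [Fact q.Prime] :
    q ^ 2 ∣ V.conductorNorm ℤ ↔
      ¬ V.HasGoodReductionAtPrime q ∧ ¬ V.HasMultiplicativeReductionAtPrime q :=
  ⟨not_good_and_not_mult_of_sq_dvd_conductorNorm, sq_dvd_conductorNorm_of_not_good_of_not_mult⟩

/-! ### From the LEVEL of the newform (modularity binder `hnf`) -/

/-- **Level-to-local glue.** If `f ∈ S₂(Γ₀(N))` is the newform of the elliptic curve `W/ℚ` and
`q² ∣ N`, then `W` is additive at `q` — GRANTED the Modularity Theorem `exists_isNewformOf` (the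
cruxes' own fact binder), through which the level of a newform of `W` is its conductor
(`IsNewformOf.level_eq_conductorNorm_of_exists_isNewformOf`, Carayol / Atkin–Lehner Thm. 4 over the
tree). [cite: DiamondShurman2005, Thm. 8.8.1] [cite: Silverman1994, IV.10.2(c)] -/
theorem not_good_and_not_mult_of_sq_dvd_level (hnf : exists_isNewformOf)
    {W : WeierstrassCurve ℚ} [W.IsElliptic] {N : ℕ} [NeZero N] {f : CuspForm (Gamma0 N) 2}
    (hf : IsNewformOf W f) {q : ℕ} [Fact q.Prime] (hqN : q ^ 2 ∣ N) :
    ¬ W.HasGoodReductionAtPrime q ∧ ¬ W.HasMultiplicativeReductionAtPrime q := by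
  have hN : N = W.conductorNorm ℤ := IsNewformOf.level_eq_conductorNorm_of_exists_isNewformOf hnf hf
  exact not_good_and_not_mult_of_sq_dvd_conductorNorm (hN ▸ hqN)

/-- The same for a modular parametrisation datum `D` of `W` at level `N` (its field `D.isNewformOf`).
[cite: DiamondShurman2005, Thm. 8.8.1] -/
theorem not_good_and_not_mult_of_sq_dvd_level_datum (hnf : exists_isNewformOf)
    {W : WeierstrassCurve ℚ} [W.IsElliptic] {N : ℕ} [NeZero N] (D : ModularParametrizationData W N)
    {q : ℕ} [Fact q.Prime] (hqN : q ^ 2 ∣ N) :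
    ¬ W.HasGoodReductionAtPrime q ∧ ¬ W.HasMultiplicativeReductionAtPrime q :=
  not_good_and_not_mult_of_sq_dvd_level hnf D.isNewformOf hqN

/-- The level of a datum is the conductor, so `q² ∣ N` transfers to `q² ∣ N(W)` (the `hqN` /
`hmN`-type side conditions of the twist-transport certificates). [cite: DiamondShurman2005, Thm. 8.8.1] -/
theorem sq_dvd_conductorNorm_of_sq_dvd_level_datum (hnf : exists_isNewformOf)
    {W : WeierstrassCurve ℚ} [W.IsElliptic] {N : ℕ} [NeZero N] (D : ModularParametrizationData W N)
    {q : ℕ} (hqN : q ^ 2 ∣ N) : q ^ 2 ∣ W.conductorNorm ℤ :=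
  (IsNewformOf.level_eq_conductorNorm_of_exists_isNewformOf hnf D.isNewformOf) ▸ hqN

/-! ### The instances the two birth skeletons consume -/

/-- C2 (`ManinOddAtFour`, stmt-BirchSwinnertonDyer-22967): a datum at a level `N` with `4 ∣ N` sits
on a curve ADDITIVE at `2` — the hypothesis `hadd` of `ManinOddAtFour_rung` /
`not_dvd_maninConstant_of_isTwistOfSemistableAtTwo_gamma0`. [cite: Silverman1994, IV.10.2(c)] -/
theorem additive_at_two_of_four_dvd_level (hnf : exists_isNewformOf)
    {W : WeierstrassCurve ℚ} [W.IsElliptic] {N : ℕ} [NeZero N] (D : ModularParametrizationData W N)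
    (h4 : 2 ^ 2 ∣ N) :
    ¬ W.HasGoodReductionAtPrime 2 ∧ ¬ W.HasMultiplicativeReductionAtPrime 2 :=
  not_good_and_not_mult_of_sq_dvd_level_datum hnf D h4

/-- C3 (`ManinPrimeToThreeAtNine`, stmt-BirchSwinnertonDyer-22968): a datum at a level `N` with
`9 ∣ N` sits on a curve ADDITIVE at `3` — the hypothesis `hadd` of `ManinPrimeToThreeAtNine_rung` /
`not_dvd_maninConstant_of_isTwistOfSemistableAt_gamma0` at `q = 3`. [cite: Silverman1994, IV.10.2(c)] -/
theorem additive_at_three_of_nine_dvd_level (hnf : exists_isNewformOf)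
    {W : WeierstrassCurve ℚ} [W.IsElliptic] {N : ℕ} [NeZero N] (D : ModularParametrizationData W N)
    (h9 : 3 ^ 2 ∣ N) :
    ¬ W.HasGoodReductionAtPrime 3 ∧ ¬ W.HasMultiplicativeReductionAtPrime 3 :=
  not_good_and_not_mult_of_sq_dvd_level_datum hnf D h9

/-- **`stub_additive_of_nine_dvd_level` of the C3 line `kato-tame-three`, PROVED** — verbatim the
registered-shape signature (es g5 skeleton, §3): under the modularity binder `hnf`, every newform `f` of
`W` at a level `N` with `9 ∣ N` has `W` additive at `3`, stated in the negative form the Kato fact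
consumes. [cite: DiamondShurman2005, Thm. 8.8.1] [cite: Silverman1994, IV.10.2(c)] -/
theorem stub_additive_of_nine_dvd_level (hnf : exists_isNewformOf) :
    ∀ (W : WeierstrassCurve ℚ) [W.IsElliptic] {N : ℕ} [NeZero N] (f : CuspForm (Gamma0 N) 2),
      IsNewformOf W f → 3 ^ 2 ∣ N →
      ¬ W.HasGoodReductionAtPrime 3 ∧ ¬ W.HasMultiplicativeReductionAtPrime 3 :=
  fun _ _ _ _ _ hf h9 ↦ not_good_and_not_mult_of_sq_dvd_level hnf hf h9

end Summit.BirchSwinnertonDyer.BirchSwinnertonDyer.Theorems.ManinLocalTwoThree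

end
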